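import Summits.HodgeConjecture.HodgeConjecture.Theorems.F0P6aLineSpecialisationGeneric
import HarnessLib

/-!
# `F0P6aLineSpecialisationLaws` — ★ RE-HOME of `Lines/F0_P6a_LineSpecialisation.lean` (tree ED. 3 sha16 d6354130763e131e), PART 5 of 6 — tree lines :1286–:1630.

See PART 1 `Theorems/F0P6aLineSpecialisationLetters.lean` for the full ★ re-home header and the original module docstring (verbatim there).  Same namespace (every fully-qualified name unchanged);
the scopes open at the cut (`noncomputable section` ∕ `namespace` ∕ `section`s) are re-opened below with their `variable` ∕ `open` ∕ `set_option` ∕ `omit` ∕ `include` ∕ `universe` lines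
replayed verbatim from the tree, in order; the code after the replay block is the tree bytes :1286–:1630, untouched.  HC_CM is proved only modulo the 7 printed citations (2 remaining: hLiu418 = stmt-HodgeConjecture-24832, h413 = stmt-HodgeConjecture-24833) until rung 0 closes; a re-home is count-neutral.
-/

-- ── replay of the scopes open at tree line :1286 (verbatim) ──
set_option autoImplicit false
set_option linter.dupNamespace false
noncomputable section
namespace Summit.HodgeConjecture.HodgeConjecture.Cruxes.HLiu418.F0P6aLineSpecialisation
open CategoryTheory CategoryTheory.Limits NumberField IsDedekindDomain MulAction AlgebraicGeometry
open scoped Matrix Polynomial Pointwise MonoidalCategory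
open Literature.NumberTheory.GaloisRepresentations
open Literature.NumberTheory.Automorphic Literature.NumberTheory.Automorphic.UnitaryGroup
open Literature.AlgebraicGeometry.ShimuraVarieties.UnitaryCanonicalModel
open Literature.NumberTheory.Automorphic.Liu2021.AppendixC
open Literature.AlgebraicGeometry.Motives (AlgPoints IntegralModel SchemeOver thickening thickeningGalAction thickeningLift specOver extendPoint
  specValuationSubring specFractionFieldι specRingHomι)
open Literature.NumberTheory.DiophantineGeometry (geomResidueField specialFibreFunctor specResidueField geomClosedPointIsoSpecResidueField
  geomResidueFieldEquiv toClosureValuationSubring)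
open Literature.AlgebraicGeometry.RelativeSpec (ActionOver)
open Literature.NumberTheory.EllipticCurves (genericFibre specGenericPoint)
open Literature.AlgebraicGeometry.AbelianSchemes Literature.AlgebraicGeometry.AbelianSchemes.AbelianSchemeOver
open Literature.AlgebraicGeometry.GroupSchemes.AffineGroupScheme (Alg)
open Summit.HodgeConjecture.HodgeConjecture.Cruxes.HLiu418.F0P6aModuliDatumDefs
open Summit.HodgeConjecture.HodgeConjecture.Cruxes.HLiu418.F0P6aRGDAssembly
open Summit.HodgeConjecture.HodgeConjecture.Cruxes.HLiu418.F0P6aDatumOfInputs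
-- ── tree bytes :1286–:1630 ──

/-! ### §1d THE DEFINITION `spGeoOf` — `spI` of the line's admissible ideal, transported to the dock along `ε` -/

section SpGeo

set_option synthInstance.maxHeartbeats 100000

open Literature.AlgebraicGeometry.GroupSchemes (GroupSchemeKernel.ker GroupSchemeKernel.kerι)
open Literature.AlgebraicGeometry.GroupSchemes.AffineGroupScheme (ptEquiv spI isHopfIdeal_and_finrank_and_map_le_spI)
open Summit.HodgeConjecture.HodgeConjecture.Cruxes.HLiu418.F0P6cDictConstructors (kerFI AdmSub IdealIsEtale IsAdm isAdm_kerFI)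

variable {F : Type} [Field F] [NumberField F] [IsCMField F] {ι₁ : F →+* ℂ}
    {Jstar : Matrix (Fin 2) (Fin 2) F}
    {K₀ : C5.OpenCompactSubgroup ↥(finAdelic ↥(maximalRealSubfield F) F (IsCMField.complexConj F) 2 Jstar)}
    {S : RecordSystemGS F Jstar ι₁ K₀} {hU7ₛ : S.HeckeTranslateDefinedOver}
    {hJ : (Jstar.map (IsCMField.complexConj F))ᵀ = Jstar} {hJu : IsUnit Jstar}
    {Fi : Type} [Field Fi] [Algebra F Fi] {Kc : C5.SmallLevel K₀} {G : Type} [Group G]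
    {𝓜 : IntegralModel (𝓞 F) F ((thickening F Fi).obj (S.M.obj Kc))}
    {w : HeightOneSpectrum (𝓞 F)} {hw : (IsCMField.complexConj F) • w ≠ w} {h𝓨 : (𝓜.localise w).IsSmoothProper 1}
    {θ : ActionOver (𝓜.localise w).total.hom ((Fi ≃ₐ[F] Fi) × G)}
    {e : Fi →ₐ[F] AlgebraicClosure (w.adicCompletion F)}

variable (I : RGDInputsAt F ι₁ Jstar K₀ S hU7ₛ hJ hJu Fi Kc G 𝓜 w hw h𝓨 θ e)

/-- **the CHOSEN §1c bijection `eLOf I y : LineOf I y ≃ {J ∕∕ AdmKOf I y J}`**. [cite: Tate1997FiniteFlatGroupSchemes, (3.7)] -/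
def eLOf (y : AlgPoints (S.M.obj Kc) (AlgebraicClosure (w.adicCompletion F))) : LineOf I y ≃ {J : Ideal (Alg (layerΩ I y)) // AdmKOf I y J} :=
  (exists_equiv_lineOf_admK I y).choose

open scoped MonObj CategoryTheory.Obj in
/-- its membership law (§1c). [cite: GortzWedhorn2023, §(27.2) (27.2.1) (p. 607)] -/
theorem eLOf_le_ker_iff (y : AlgPoints (S.M.obj Kc) (AlgebraicClosure (w.adicCompletion F))) (L : LineOf I y) (s : specOver (AlgebraicClosure (w.adicCompletion F)) (AlgebraicClosure (w.adicCompletion F)) ⟶ layerΩ I y) :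
    haveI := isMonHom_transR I y
    haveI := isAffine_layerΩ_left I y
    (eLOf I y L).1 ≤ RingHom.ker (ptEquiv (layerΩ I y) (AlgebraicClosure (w.adicCompletion F)) s).toRingHom ↔
      (s ≫ (Over.pullback (sΩ w)).map (ιR I y) ≫ (isoGenericOf I y).inv : (fibreΩOf S Kc 𝓜 w e I.univ y).Points (AlgebraicClosure (w.adicCompletion F))) ∈ L.1 :=
  (exists_equiv_lineOf_admK I y).choose_spec L s

variable [ExpChar (geomResidueField w) I.pChar] (𝔡 : ∀ xbar, DockAt I xbar)

/-- **the CHOSEN §1b identification `εOf I 𝔡 y : layerκ I y ≅ (𝔡 (red₀ y)).G₀`**. [cite: Tate1997FiniteFlatGroupSchemes, (3.7)] -/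
def εOf (y : AlgPoints (S.M.obj Kc) (AlgebraicClosure (w.adicCompletion F))) : layerκ I y ≅ (𝔡 (red₀Of S Kc 𝓜 w h𝓨 e y)).G₀ :=
  (exists_iso_dock_layerR I 𝔡 y).choose

open scoped MonObj CategoryTheory.Obj in
/-- `εOf` is a homomorphism. [cite: Tate1997FiniteFlatGroupSchemes, (3.7)] -/
theorem isMonHom_εOf_hom (y : AlgPoints (S.M.obj Kc) (AlgebraicClosure (w.adicCompletion F))) :
    letI := (𝔡 (red₀Of S Kc 𝓜 w h𝓨 e y)).grp₀
    haveI := isMonHom_transR I y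
    IsMonHom (εOf I 𝔡 y).hom :=
  (exists_iso_dock_layerR I 𝔡 y).choose_spec.1

/-- `εOf` lies over `A`: `ε ≫ ι₀G ≫ (σ2) = (ιR)_κ̄`. [cite: Tate1997FiniteFlatGroupSchemes, (3.7)] -/
theorem εOf_hom_comp_ι₀G_comp_isoSpecialOf_hom (y : AlgPoints (S.M.obj Kc) (AlgebraicClosure (w.adicCompletion F))) :
    (εOf I 𝔡 y).hom ≫ (𝔡 (red₀Of S Kc 𝓜 w h𝓨 e y)).ι₀G ≫ (isoSpecialOf I y).hom = (Over.pullback (sκ w)).map (ιR I y) :=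
  (exists_iso_dock_layerR I 𝔡 y).choose_spec.2.1

/-- `εOf` is `𝒪_F`-equivariant: `(βR a)_κ̄ ≫ ε = ε ≫ β₀ a`. [cite: Kottwitz1992, §5, p. 390] -/
theorem map_βR_comp_εOf_hom (y : AlgPoints (S.M.obj Kc) (AlgebraicClosure (w.adicCompletion F))) (a : 𝓞 F) :
    (Over.pullback (sκ w)).map (βR I y a) ≫ (εOf I 𝔡 y).hom = (εOf I 𝔡 y).hom ≫ (𝔡 (red₀Of S Kc 𝓜 w h𝓨 e y)).β₀ a :=
  (exists_iso_dock_layerR I 𝔡 y).choose_spec.2.2 a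

omit [ExpChar (geomResidueField w) I.pChar] in
open scoped MonObj CategoryTheory.Obj in
/-- **`spIOf I y L := spI Ω̄ κ̄ (layerR I y) (eL L)`** — the specialised ideal on `Γ(layerκ I y)` BEFORE transport (★ `spI` under `(toGeomκ w).toAlgebra`).
[cite: EGAIV2, Prop. 2.8.5] -/
def spIOf (y : AlgPoints (S.M.obj Kc) (AlgebraicClosure (w.adicCompletion F))) (L : LineOf I y) : Ideal (Alg (layerκ I y)) :=
  letI := (toGeomκ w).toAlgebra
  haveI := isMonHom_transR I y
  haveI := isAffine_layerR_left I y
  haveI := isAffine_layerκ_left I y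
  haveI := isAffine_layerΩ_left I y
  spI (AlgebraicClosure (w.adicCompletion F)) (geomResidueField w) (layerR I y) (eLOf I y L).1

omit [ExpChar (geomResidueField w) I.pChar] in
set_option maxHeartbeats 400000 in
open scoped MonObj CategoryTheory.Obj in
/-- **`spIOf` IS ADMISSIBLE** on `layerκ I y` for `(βR ·)_κ̄` — ★ S1 `isHopfIdeal_and_finrank_and_map_le_spI` (`R = 𝒪_Ω̄` a valuation ring with fraction field `Ω̄`,
`Γ(layerR)` module-finite). [cite: EGAIV2, Prop. 2.8.5] [cite: Milne2017, 1.e, Ch. 3 §b Props. 3.11 and 3.15] -/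
theorem isAdm_spIOf (y : AlgPoints (S.M.obj Kc) (AlgebraicClosure (w.adicCompletion F))) (L : LineOf I y) :
    haveI := isMonHom_transR I y
    haveI := isAffine_layerκ_left I y
    (spIOf I y L).IsHopfIdeal (geomResidueField w) ∧
      Module.finrank (geomResidueField w) (Alg (layerκ I y) ⧸ spIOf I y L) = I.pChar ^ I.fDeg ∧
      ∀ a : 𝓞 F, (spIOf I y L).map ((Over.pullback (sκ w)).map (βR I y a)).left.appTop.hom ≤ spIOf I y L := by
  letI := (toGeomκ w).toAlgebra
  haveI := isMonHom_transR I y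
  haveI := isAffine_layerR_left I y
  haveI := isAffine_layerκ_left I y
  haveI := isAffine_layerΩ_left I y
  haveI := moduleFinite_alg_layerR I y
  exact isHopfIdeal_and_finrank_and_map_le_spI (AlgebraicClosure (w.adicCompletion F)) (geomResidueField w) (layerR I y) (βR I y) (I.pChar ^ I.fDeg)
    (eLOf I y L).1 (eLOf I y L).2

set_option maxHeartbeats 400000 in
open scoped MonObj CategoryTheory.Obj in
/-- **`spIOf` TRANSPORTED ALONG `ε` IS ADMISSIBLE ON THE DOCK** (★ `AdmIdealTransport.isHopfIdeal_and_finrank_and_map_le_comap_appTop` with `hββ' := map_βR_comp_εOf_hom`).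
[cite: Tate1997FiniteFlatGroupSchemes, (3.7)] [cite: GortzWedhorn2023, (27.1.1) and §(27.2) (p. 607)] -/
theorem isAdm_comap_εOf (y : AlgPoints (S.M.obj Kc) (AlgebraicClosure (w.adicCompletion F))) (L : LineOf I y) :
    letI := (𝔡 (red₀Of S Kc 𝓜 w h𝓨 e y)).grp₀
    haveI := (𝔡 (red₀Of S Kc 𝓜 w h𝓨 e y)).aff₀
    IsAdm (𝔡 (red₀Of S Kc 𝓜 w h𝓨 e y)).G₀ (𝔡 (red₀Of S Kc 𝓜 w h𝓨 e y)).β₀ (I.pChar ^ I.fDeg) ((spIOf I y L).comap (εOf I 𝔡 y).hom.left.appTop.hom) := by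
  letI := (𝔡 (red₀Of S Kc 𝓜 w h𝓨 e y)).grp₀
  haveI := (𝔡 (red₀Of S Kc 𝓜 w h𝓨 e y)).aff₀
  haveI := isMonHom_transR I y
  haveI := isAffine_layerκ_left I y
  haveI := isMonHom_εOf_hom I 𝔡 y
  exact Literature.AlgebraicGeometry.GroupSchemes.AdmIdealTransport.isHopfIdeal_and_finrank_and_map_le_comap_appTop (εOf I 𝔡 y)
    (fun a => (Over.pullback (sκ w)).map (βR I y a)) (𝔡 (red₀Of S Kc 𝓜 w h𝓨 e y)).β₀ (map_βR_comp_εOf_hom I 𝔡 y) (isAdm_spIOf I y L)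

/-- **§1d `spGeoOf I 𝔡 y L : SubOf I 𝔡 (red₀ y)`** — THE SPECIALISATION OF THE LINE `L`: `spI` of its admissible ideal `eL L` on the (S-c) layer of the lift, transported to the dock
`G₀ (red₀ y)` along `ε` (`Ideal.comap Γ(ε.hom)`), admissible by `isAdm_comap_εOf`.  (`SubOf I 𝔡 x̄ = AdmSub (G₀ x̄) (β₀ x̄) q`.) [cite: EGAIV2, Prop. 2.8.5]
[cite: Tate1997FiniteFlatGroupSchemes, (3.7)] [cite: Liu2021, p. 137] -/
def spGeoOf (y : AlgPoints (S.M.obj Kc) (AlgebraicClosure (w.adicCompletion F))) (L : LineOf I y) : SubOf I 𝔡 (red₀Of S Kc 𝓜 w h𝓨 e y) :=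
  ⟨(spIOf I y L).comap (εOf I 𝔡 y).hom.left.appTop.hom, isAdm_comap_εOf I 𝔡 y L⟩

/-- Unfolding `spGeoOf` on the ideal. [cite: EGAIV2, Prop. 2.8.5] -/
theorem spGeoOf_val (y : AlgPoints (S.M.obj Kc) (AlgebraicClosure (w.adicCompletion F))) (L : LineOf I y) : (spGeoOf I 𝔡 y L).1 = (spIOf I y L).comap (εOf I 𝔡 y).hom.left.appTop.hom := rfl

end SpGeo

/-! ### §1e₀ two facts about `toGeomκ` -/

section ResidueFacts

variable {F : Type} [Field F] [NumberField F] (w : HeightOneSpectrum (𝓞 F))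

/-- `toGeomκ w` is surjective (residue map onto `κ(R)`, then an equivalence). [cite: SerreTate1968, §1 Lemma 2] -/
theorem toGeomκ_surjective : Function.Surjective (toGeomκ w) :=
  (geomResidueFieldEquiv w).symm.surjective.comp IsLocalRing.residue_surjective

/-- `ker (toGeomκ w) = 𝔪_R`. [cite: SerreTate1968, §1 Lemma 2] -/
theorem ker_toGeomκ : RingHom.ker (toGeomκ w) = IsLocalRing.maximalIdeal ↥(closureValuationSubring (w.adicCompletion F)) := by
  rw [toGeomκ, RingHom.ker_comp_of_injective _ (geomResidueFieldEquiv w).symm.injective, IsLocalRing.ker_residue]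

end ResidueFacts

/-! ### §1e THE LAWS OF `spGeoOf` — transports along `εOf`, ★ (E-b4′), ★ SP-SURJ -/

section Laws

set_option synthInstance.maxHeartbeats 100000

open Literature.AlgebraicGeometry.GroupSchemes (GroupSchemeKernel.ker GroupSchemeKernel.kerι natCard_sections_eq_natCard_algHom)
open Literature.AlgebraicGeometry.GroupSchemes.AffineGroupScheme (ptEquiv spI)
open Literature.AlgebraicGeometry.GroupSchemes.AdmIdealTransport
open Literature.AlgebraicGeometry.Motives (relFrobeniusOver frobeniusTwistOver)
open Summit.HodgeConjecture.HodgeConjecture.Cruxes.HLiu418.F0P6cDictConstructors (kerFI AdmSub IdealIsEtale IsAdm isAdm_kerFI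
  eq_kerFI_or_idealIsEtale_of_isAdm)

variable {F : Type} [Field F] [NumberField F] [IsCMField F] {ι₁ : F →+* ℂ}
    {Jstar : Matrix (Fin 2) (Fin 2) F}
    {K₀ : C5.OpenCompactSubgroup ↥(finAdelic ↥(maximalRealSubfield F) F (IsCMField.complexConj F) 2 Jstar)}
    {S : RecordSystemGS F Jstar ι₁ K₀} {hU7ₛ : S.HeckeTranslateDefinedOver}
    {hJ : (Jstar.map (IsCMField.complexConj F))ᵀ = Jstar} {hJu : IsUnit Jstar}
    {Fi : Type} [Field Fi] [Algebra F Fi] {Kc : C5.SmallLevel K₀} {G : Type} [Group G]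
    {𝓜 : IntegralModel (𝓞 F) F ((thickening F Fi).obj (S.M.obj Kc))}
    {w : HeightOneSpectrum (𝓞 F)} {hw : (IsCMField.complexConj F) • w ≠ w} {h𝓨 : (𝓜.localise w).IsSmoothProper 1}
    {θ : ActionOver (𝓜.localise w).total.hom ((Fi ≃ₐ[F] Fi) × G)}
    {e : Fi →ₐ[F] AlgebraicClosure (w.adicCompletion F)}

variable (I : RGDInputsAt F ι₁ Jstar K₀ S hU7ₛ hJ hJu Fi Kc G 𝓜 w hw h𝓨 θ e) [ExpChar (geomResidueField w) I.pChar] (𝔡 : ∀ xbar, DockAt I xbar)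

omit [ExpChar (geomResidueField w) I.pChar] in
/-- `layerκ I y → Spec κ̄` is finite (base change of the finite `layerR I y`). [cite: GortzWedhorn2023, Cor. 27.177 (1)] -/
theorem isFinite_layerκ_hom (y : AlgPoints (S.M.obj Kc) (AlgebraicClosure (w.adicCompletion F))) : IsFinite (layerκ I y).hom := by
  haveI := isFinite_layerR_hom I y
  exact MorphismProperty.pullback_snd _ _ inferInstance

omit [ExpChar (geomResidueField w) I.pChar] in
/-- **`Γ(φ)⁻¹` IS INJECTIVE ON IDEALS** for an isomorphism `φ` (★ `comap_appTop_inv_comap_appTop_hom` is a left inverse). [cite: GortzWedhorn2023, (27.1.1)] -/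
theorem comap_appTop_injective {R₀ : Type} [CommRing R₀] {G₁ G₂ : SchemeOver R₀} (φ : G₁ ≅ G₂) {J₁ J₂ : Ideal (Alg G₁)}
    (h : (J₁.comap φ.hom.left.appTop.hom : Ideal (Alg G₂)) = J₂.comap φ.hom.left.appTop.hom) : J₁ = J₂ := by
  exact ((comap_appTop_inv_comap_appTop_hom φ J₁).symm.trans
    ((congrArg (fun J' : Ideal (Alg G₂) => (J'.comap φ.inv.left.appTop.hom : Ideal (Alg G₁))) h).trans
      (comap_appTop_inv_comap_appTop_hom φ J₂)))

/-- Unfolding `kerFOf` on the ideal. [cite: SGA3I, VII_A 4.1] -/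
theorem kerFOf_val (xbar : AlgPoints (𝓜.localise w).reductionAt (geomResidueField w)) :
    (kerFOf I 𝔡 xbar).1 = (letI := (𝔡 xbar).grp₀; kerFI I.pChar I.fDeg (𝔡 xbar).G₀) := rfl

open scoped MonObj CategoryTheory.Obj in
/-- **the Frobenius-kernel ideal moves along `εOf`**: `Γ(ε)⁻¹ (kerFI (layerκ I y)) = kerFI (G₀ (red₀ y))` (★ `AdmIdealTransport` §5).
[cite: SGA3I, VII_A 4.1] -/
theorem comap_εOf_kerFI (y : AlgPoints (S.M.obj Kc) (AlgebraicClosure (w.adicCompletion F))) :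
    letI := (𝔡 (red₀Of S Kc 𝓜 w h𝓨 e y)).grp₀
    haveI := isMonHom_transR I y
    ((kerFI I.pChar I.fDeg (layerκ I y)).comap (εOf I 𝔡 y).hom.left.appTop.hom : Ideal (Alg (𝔡 (red₀Of S Kc 𝓜 w h𝓨 e y)).G₀)) =
      kerFI I.pChar I.fDeg (𝔡 (red₀Of S Kc 𝓜 w h𝓨 e y)).G₀ := by
  letI := (𝔡 (red₀Of S Kc 𝓜 w h𝓨 e y)).grp₀
  haveI := isMonHom_transR I y
  haveI := isMonHom_εOf_hom I 𝔡 y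
  exact comap_appTop_ker_kerι_relFrobeniusOver I.pChar I.fDeg (εOf I 𝔡 y)

set_option maxHeartbeats 400000 in
open scoped MonObj CategoryTheory.Obj in
/-- **`spGeoOf y L = kerF (red₀ y)` IFF `spI (eL L) = kerFI (layerκ I y)`** (`Γ(ε)⁻¹` is injective on ideals and moves `kerFI` to `kerFI`; term-mode, no `rw` on dock ideals).
[cite: SGA3I, VII_A 4.1] [cite: EGAIV2, Prop. 2.8.5] -/
theorem spGeoOf_eq_kerFOf_iff (y : AlgPoints (S.M.obj Kc) (AlgebraicClosure (w.adicCompletion F))) (L : LineOf I y) :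
    spGeoOf I 𝔡 y L = kerFOf I 𝔡 (red₀Of S Kc 𝓜 w h𝓨 e y) ↔
      (haveI := isMonHom_transR I y; spIOf I y L = kerFI I.pChar I.fDeg (layerκ I y)) := by
  letI := (𝔡 (red₀Of S Kc 𝓜 w h𝓨 e y)).grp₀
  haveI := (𝔡 (red₀Of S Kc 𝓜 w h𝓨 e y)).aff₀
  haveI := isMonHom_transR I y
  constructor
  · intro h
    exact comap_appTop_injective (εOf I 𝔡 y)
      (((spGeoOf_val I 𝔡 y L).symm.trans ((congrArg Subtype.val h).trans (kerFOf_val I 𝔡 (red₀Of S Kc 𝓜 w h𝓨 e y)))).trans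
        (comap_εOf_kerFI I 𝔡 y).symm)
  · intro h
    exact Subtype.ext (((spGeoOf_val I 𝔡 y L).trans ((congrArg (fun J : Ideal (Alg (layerκ I y)) =>
      (J.comap (εOf I 𝔡 y).hom.left.appTop.hom : Ideal (Alg (𝔡 (red₀Of S Kc 𝓜 w h𝓨 e y)).G₀))) h).trans (comap_εOf_kerFI I 𝔡 y))).trans
        (kerFOf_val I 𝔡 (red₀Of S Kc 𝓜 w h𝓨 e y)).symm)

/-- **`#layerκ(κ̄) = #G₀(κ̄)`** (composition with `εOf`). [cite: Tate1997FiniteFlatGroupSchemes, (3.7)] -/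
theorem natCard_sections_layerκ_eq (y : AlgPoints (S.M.obj Kc) (AlgebraicClosure (w.adicCompletion F))) :
    Nat.card (𝟙_ (SchemeOver (geomResidueField w)) ⟶ layerκ I y) = Nat.card (𝟙_ (SchemeOver (geomResidueField w)) ⟶ (𝔡 (red₀Of S Kc 𝓜 w h𝓨 e y)).G₀) :=
  Nat.card_congr ((Iso.refl _).homCongr (εOf I 𝔡 y))

include 𝔡 in
/-- **`rk_κ̄ Γ(layerκ I y) = q²`** (the dock row `hrkG₀` through `Γ(ε)`). [cite: Liu2021, p. 137] [cite: RapoportSmithlingZhang2020Diagonal, §4.1 p. 17] -/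
theorem finrank_alg_layerκ_eq (y : AlgPoints (S.M.obj Kc) (AlgebraicClosure (w.adicCompletion F))) :
    Module.finrank (geomResidueField w) (Alg (layerκ I y)) = I.pChar ^ I.fDeg * I.pChar ^ I.fDeg := by
  haveI := (𝔡 (red₀Of S Kc 𝓜 w h𝓨 e y)).aff₀
  obtain ⟨eA, -, -⟩ := exists_algEquiv_of_iso (εOf I 𝔡 y)
  rw [← eA.toLinearEquiv.finrank_eq]
  exact (𝔡 (red₀Of S Kc 𝓜 w h𝓨 e y)).hrkG₀

include 𝔡 in
set_option maxHeartbeats 400000 in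
open scoped MonObj CategoryTheory.Obj in
/-- **`rk_κ̄ (Γ(layerκ I y) ⧸ kerFI) = q`** (the dock row `hrkF₀` through `Γ(ε)`, `comap_εOf_kerFI`). [cite: Liu2021, p. 137] -/
theorem finrank_quotient_kerFI_layerκ_eq (y : AlgPoints (S.M.obj Kc) (AlgebraicClosure (w.adicCompletion F))) :
    haveI := isMonHom_transR I y
    Module.finrank (geomResidueField w) (Alg (layerκ I y) ⧸ kerFI I.pChar I.fDeg (layerκ I y)) = I.pChar ^ I.fDeg := by
  letI := (𝔡 (red₀Of S Kc 𝓜 w h𝓨 e y)).grp₀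
  haveI := (𝔡 (red₀Of S Kc 𝓜 w h𝓨 e y)).aff₀
  haveI := isMonHom_transR I y
  have h := finrank_quotient_comap_appTop (εOf I 𝔡 y) (kerFI I.pChar I.fDeg (layerκ I y))
  have h0 : Module.finrank (geomResidueField w) (Alg (𝔡 (red₀Of S Kc 𝓜 w h𝓨 e y)).G₀ ⧸ kerFI I.pChar I.fDeg (𝔡 (red₀Of S Kc 𝓜 w h𝓨 e y)).G₀) = I.pChar ^ I.fDeg := (𝔡 (red₀Of S Kc 𝓜 w h𝓨 e y)).hrkF₀
  exact (h.symm.trans (Ideal.quotientEquivAlgOfEq (geomResidueField w) (comap_εOf_kerFI I 𝔡 y)).toLinearEquiv.finrank_eq).trans h0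

set_option maxHeartbeats 400000 in
open scoped MonObj CategoryTheory.Obj in
/-- **an admissible ideal of the dock moves to an admissible ideal of `layerκ I y` along `εOf⁻¹`** (★ `AdmIdealTransport` at `εOf.symm`, `hββ'` from
`map_βR_comp_εOf_hom`). [cite: Tate1997FiniteFlatGroupSchemes, (3.7)] -/
theorem isAdm_comap_εOf_inv (y : AlgPoints (S.M.obj Kc) (AlgebraicClosure (w.adicCompletion F))) (H : SubOf I 𝔡 (red₀Of S Kc 𝓜 w h𝓨 e y)) :
    haveI := isMonHom_transR I y
    haveI := isAffine_layerκ_left I y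
    (H.1.comap (εOf I 𝔡 y).inv.left.appTop.hom : Ideal (Alg (layerκ I y))).IsHopfIdeal (geomResidueField w) ∧
      Module.finrank (geomResidueField w) (Alg (layerκ I y) ⧸ (H.1.comap (εOf I 𝔡 y).inv.left.appTop.hom : Ideal (Alg (layerκ I y)))) = I.pChar ^ I.fDeg ∧
      ∀ a : 𝓞 F, (H.1.comap (εOf I 𝔡 y).inv.left.appTop.hom : Ideal (Alg (layerκ I y))).map
          ((Over.pullback (sκ w)).map (βR I y a)).left.appTop.hom ≤
        (H.1.comap (εOf I 𝔡 y).inv.left.appTop.hom : Ideal (Alg (layerκ I y))) := by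
  letI := (𝔡 (red₀Of S Kc 𝓜 w h𝓨 e y)).grp₀
  haveI := (𝔡 (red₀Of S Kc 𝓜 w h𝓨 e y)).aff₀
  haveI := isMonHom_transR I y
  haveI := isAffine_layerκ_left I y
  haveI := isMonHom_εOf_hom I 𝔡 y
  haveI : IsMonHom (εOf I 𝔡 y).symm.hom := by
    show IsMonHom (εOf I 𝔡 y).inv
    infer_instance
  have hββ' : ∀ a : 𝓞 F, (𝔡 (red₀Of S Kc 𝓜 w h𝓨 e y)).β₀ a ≫ (εOf I 𝔡 y).symm.hom =
      (εOf I 𝔡 y).symm.hom ≫ (Over.pullback (sκ w)).map (βR I y a) := fun a => by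
    rw [Iso.symm_hom, Iso.eq_inv_comp, ← Category.assoc, Iso.comp_inv_eq]
    exact (map_βR_comp_εOf_hom I 𝔡 y a).symm
  exact isHopfIdeal_and_finrank_and_map_le_comap_appTop (εOf I 𝔡 y).symm (𝔡 (red₀Of S Kc 𝓜 w h𝓨 e y)).β₀
    (fun a => (Over.pullback (sκ w)).map (βR I y a)) hββ' H.2

open scoped MonObj CategoryTheory.Obj in
/-- **an ÉTALE admissible subgroup of the dock gives an étale admissible ideal of `layerκ I y`** (`hord` of ★ (E-b4′); étaleness moves by ★
`etale_specOver_quotient_comap_appTop_iff`). [cite: Tate1997FiniteFlatGroupSchemes, (3.7)] -/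
theorem exists_admissible_etale_layerκ (y : AlgPoints (S.M.obj Kc) (AlgebraicClosure (w.adicCompletion F))) (h : ∃ H : SubOf I 𝔡 (red₀Of S Kc 𝓜 w h𝓨 e y), IsEtaleOf I 𝔡 H) :
    haveI := isMonHom_transR I y
    haveI := isAffine_layerκ_left I y
    ∃ J : Ideal (Alg (layerκ I y)),
      (J.IsHopfIdeal (geomResidueField w) ∧ Module.finrank (geomResidueField w) (Alg (layerκ I y) ⧸ J) = I.pChar ^ I.fDeg ∧
        ∀ a : 𝓞 F, J.map ((Over.pullback (sκ w)).map (βR I y a)).left.appTop.hom ≤ J) ∧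
      Etale (specOver (geomResidueField w) (Alg (layerκ I y) ⧸ J)).hom := by
  letI := (𝔡 (red₀Of S Kc 𝓜 w h𝓨 e y)).grp₀
  haveI := (𝔡 (red₀Of S Kc 𝓜 w h𝓨 e y)).aff₀
  haveI := isMonHom_transR I y
  haveI := isAffine_layerκ_left I y
  obtain ⟨H, hH⟩ := h
  exact ⟨H.1.comap (εOf I 𝔡 y).inv.left.appTop.hom, isAdm_comap_εOf_inv I 𝔡 y H,
    (etale_specOver_quotient_comap_appTop_iff (εOf I 𝔡 y).symm H.1).mpr hH⟩

/-- **DICHOTOMY AT THE DOCK** (the L3 leaf's `eq_kerFOf_or_isEtaleOf`, same 10 lines: P6c (b) `eq_kerFI_or_idealIsEtale_of_isAdm` at the dock rows). [cite: Tate1997FiniteFlatGroupSchemes, (3.7)]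
[cite: Liu2021, p. 137] -/
theorem eq_kerFOf_or_isEtaleOf (xbar : AlgPoints (𝓜.localise w).reductionAt (geomResidueField w)) (H : SubOf I 𝔡 xbar) :
    H = kerFOf I 𝔡 xbar ∨ IsEtaleOf I 𝔡 H := by
  haveI : Fact I.pChar.Prime := ⟨I.hpChar.1⟩
  haveI : CharP (geomResidueField w) I.pChar := I.charP₀
  letI := (𝔡 xbar).grp₀
  haveI := (𝔡 xbar).aff₀
  haveI := (𝔡 xbar).fin₀
  letI := (𝔡 xbar).grpU₀
  haveI := (𝔡 xbar).affU₀
  rcases eq_kerFI_or_idealIsEtale_of_isAdm I.pChar I.fDeg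
      (𝔡 xbar).G₀ (𝔡 xbar).β₀ (𝔡 xbar).hβ₀ (𝔡 xbar).U₀ (𝔡 xbar).jU₀ (𝔡 xbar).hU₀ (𝔡 xbar).NU₀ (𝔡 xbar).θU₀ (𝔡 xbar).hrkF₀ (𝔡 xbar).hpts₀
      (𝔡 xbar).hsimple₀ H.1 H.2 with h | h
  · exact Or.inl (Subtype.ext h)
  · exact Or.inr h

set_option maxHeartbeats 400000 in
open scoped MonObj CategoryTheory.Obj in
/-- **any admissible ideal of `layerκ I y` moves to a member of `SubOf` along `εOf`** (★ `AdmIdealTransport` HEAD, `hββ' := map_βR_comp_εOf_hom`).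
[cite: Tate1997FiniteFlatGroupSchemes, (3.7)] -/
theorem isAdm_comap_εOf_hom (y : AlgPoints (S.M.obj Kc) (AlgebraicClosure (w.adicCompletion F))) (J : Ideal (Alg (layerκ I y)))
    (hJ : haveI := isMonHom_transR I y; haveI := isAffine_layerκ_left I y;
      J.IsHopfIdeal (geomResidueField w) ∧ Module.finrank (geomResidueField w) (Alg (layerκ I y) ⧸ J) = I.pChar ^ I.fDeg ∧
        ∀ a : 𝓞 F, J.map ((Over.pullback (sκ w)).map (βR I y a)).left.appTop.hom ≤ J) :
    letI := (𝔡 (red₀Of S Kc 𝓜 w h𝓨 e y)).grp₀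
    haveI := (𝔡 (red₀Of S Kc 𝓜 w h𝓨 e y)).aff₀
    IsAdm (𝔡 (red₀Of S Kc 𝓜 w h𝓨 e y)).G₀ (𝔡 (red₀Of S Kc 𝓜 w h𝓨 e y)).β₀ (I.pChar ^ I.fDeg) (J.comap (εOf I 𝔡 y).hom.left.appTop.hom) := by
  letI := (𝔡 (red₀Of S Kc 𝓜 w h𝓨 e y)).grp₀
  haveI := (𝔡 (red₀Of S Kc 𝓜 w h𝓨 e y)).aff₀
  haveI := isMonHom_transR I y
  haveI := isAffine_layerκ_left I y
  haveI := isMonHom_εOf_hom I 𝔡 y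
  exact isHopfIdeal_and_finrank_and_map_le_comap_appTop (εOf I 𝔡 y) (fun a => (Over.pullback (sκ w)).map (βR I y a)) (𝔡 (red₀Of S Kc 𝓜 w h𝓨 e y)).β₀
    (map_βR_comp_εOf_hom I 𝔡 y) hJ

include 𝔡 in
set_option maxHeartbeats 400000 in
open scoped MonObj CategoryTheory.Obj in
/-- **DICHOTOMY ON `layerκ I y`**: an admissible ideal is the Frobenius-kernel ideal or étale — `eq_kerFOf_or_isEtaleOf` at the transported member
`⟨Γ(ε)⁻¹ J, isAdm_comap_εOf_hom⟩`, moved back along `εOf` (`comap_εOf_kerFI`, ★ `etale_specOver_quotient_comap_appTop_iff`). [cite: Tate1997FiniteFlatGroupSchemes, (3.7)]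
[cite: HarrisTaylorAMS2001, Lemma II.2.1] -/
theorem eq_kerFI_or_etale_layerκ (y : AlgPoints (S.M.obj Kc) (AlgebraicClosure (w.adicCompletion F))) :
    haveI := isMonHom_transR I y
    haveI := isAffine_layerκ_left I y
    ∀ J : Ideal (Alg (layerκ I y)),
      (J.IsHopfIdeal (geomResidueField w) ∧ Module.finrank (geomResidueField w) (Alg (layerκ I y) ⧸ J) = I.pChar ^ I.fDeg ∧
        ∀ a : 𝓞 F, J.map ((Over.pullback (sκ w)).map (βR I y a)).left.appTop.hom ≤ J) →
      J = kerFI I.pChar I.fDeg (layerκ I y) ∨ Etale (specOver (geomResidueField w) (Alg (layerκ I y) ⧸ J)).hom := by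
  letI := (𝔡 (red₀Of S Kc 𝓜 w h𝓨 e y)).grp₀
  haveI := (𝔡 (red₀Of S Kc 𝓜 w h𝓨 e y)).aff₀
  haveI := isMonHom_transR I y
  haveI := isAffine_layerκ_left I y
  intro J hJ
  rcases eq_kerFOf_or_isEtaleOf I 𝔡 (red₀Of S Kc 𝓜 w h𝓨 e y) ⟨J.comap (εOf I 𝔡 y).hom.left.appTop.hom, isAdm_comap_εOf_hom I 𝔡 y J hJ⟩ with h | h
  · left
    exact comap_appTop_injective (εOf I 𝔡 y)
      (((congrArg Subtype.val h).trans (kerFOf_val I 𝔡 (red₀Of S Kc 𝓜 w h𝓨 e y))).trans (comap_εOf_kerFI I 𝔡 y).symm)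
  · right
    exact (etale_specOver_quotient_comap_appTop_iff (εOf I 𝔡 y) J).mp h


/-! (★ re-home, size lint: PART 5 of 6 ends here at tree line :1630; continued in `Theorems/F0P6aLineSpecialisation.lean`.) -/

end Laws
end Summit.HodgeConjecture.HodgeConjecture.Cruxes.HLiu418.F0P6aLineSpecialisation
end
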